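import Summits.QuantumFields.BalabanUV.T4Continuum.Support.MinimalActionDictionary
import HarnessLib

/-!
# T⁴ programme, node NE3 (η-rate of the minimisers) — THE DICTIONARY, part 2 (END): B11 Theorem 1 for the torus
# instances ⇒ the sandwich's `UpperData` ⇒ the minimal actions `A_k(V)` CONVERGE

NE3 formalisation swarm of the cell `pub-balaban`, crew item (s3) of the row-owner skeleton
`t4/b2b-balaban-t4-ne3-p1/SKELETON-NE3-P1.md` v1.1 §6, leaf seat `b2b-balaban-t4-ne3-formalise-leaf-06`; claim table
`t4/formal/NE3/LEAVES.md` row S3.  Part 1 = `MinimalActionDictionary` (the instance `torusVP`, the regularity device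
`gauge_of_regularity`, the level-dependent radius `thm1Radius`∕`thm1Class` with `radius_step`).

**THE END (`upperData_of_thm1At`)**: if Theorem 1 at constants `C` holds for the torus instances of all levels `k ≥ 1`
(`∀ k, Thm1At C (torusVP d L N G (k+1))` — a HYPOTHESIS, asserted for nothing), if the local-gauge shape `G` is
monotone in its radii (`RadiiMono`) and feeds the `ℓ²` flux-gradient slot (`hgrad` — the exact statement of row NE3-R2's
`AveragingDeficitKDatumTorus.gradFluxSq_period_le_scaling` for `G = ExpGauge d`, to be supplied BY NAME when that module
is in the tree; `G` also monotone in the cube, `hGbox`), for regularity cubes `box (Kc j) (L^j•q)` of PRINT-ADMISSIBLE size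
around every block (`cubeM L j (Kc j) ≤ M(ε₁^{(j)})`, containing the slot boxes, radii `B₃·M_j·ε₁^{(j)} ≤ c`), and under
explicit smallness of `ε₁` (`(7∕3)ε₁ ≤ a₁`, `512(d+1)(d+4)L²·(7∕3)B₃ε₁ ≤ 1`, `49·C₀·B₃ε₁ ≤ 9`), every datum
`V ∈ sfClass d L N ε₁ 0` (hypothesis (7)) has
`UpperData d (thm1Class d L N C ε₁) L N ((7∕3)B₃ε₁) g V`: (H1) ⇐ (8) `Exists8` at `ε₁^{(k)}`; (H3) ⇐ (8) + (9)–(10)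
`Reg910` through `gauge_of_regularity` and `hgrad`; (H4) = B7 Prop. 1 (tree `smallField_rescale_bavg`) + `radius_step`.
Hence (**`exists_tendsto_minAct_of_thm1At`**, via the owner's `MinimalActionLimit.exists_tendsto_minAct`) the minimal
actions `A_k(V) = minAct d (thm1Class …) L N k V` CONVERGE — the rung-(B)+1 statement «existence of the `ε → 0` limit of
the minimal actions», resting on `Thm1At` LITERALLY (skeleton §6 (s3)) and on the `G`-gradient slot.

HONEST FRAMING.  Finite-T⁴ ultraviolet bookkeeping about MINIMISERS.  NOTHING of B11 is asserted: `Thm1At …` is a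
HYPOTHESIS of both theorems, B11 Theorem 1 being the manuscript under audit (ABSOLUTE RULE of the cell); no `sorry`, no
axioms beyond Mathlib's; no conditional of the cell (`BetaPertH`, (B), (B^μ)) occurs; nothing bears on infinite volume, a
mass gap, or the Clay problem; **NE3 is NOT proved** — the headline reads «NE3-(A), existence of `lim A_k(V)`, CONDITIONAL
on ⟨`Thm1At` for the torus instances⟩ + ⟨the `G`-gradient slot⟩».  Divergences from print: part 1, D-s3-1 … D-s3-6.
PLACEMENT (human rule 2026-08-19): cell work under `Summits/QuantumFields/BalabanUV/`; imports part 1 only; moves nothing.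
Context: T. Bałaban, Commun. Math. Phys. **102** (1985) 277–309 [Balaban1985Variational], Thm 1 (8)–(10) p. 279;
**98** (1985) 17–51 [Balaban1985Averaging], Prop. 1 (51) p. 26.  Records: `t4/formal/NE3/LEAVES.md` row S3.
-/

set_option autoImplicit false

open scoped BigOperators Matrix Matrix.Norms.L2Operator Topology
open NormedSpace Finset Filter

namespace Summit.QuantumFields.BalabanUV.T4Continuum.MinimalActionFromThm1

open Literature.MathematicalPhysics.QuantumFieldTheory.Balaban1983to89
open B7Prop1Explicit B7Prop2Explicit MatrixLog UnitaryModel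
open T4AveragingDeficitWall hiding Site Plane Plaq Bond
open T4AveragingDeficitWallBoundary (IsPeriodicCfg periodBox)
open MinimalActionLevels MinimalActionSandwich MinimalActionRate MinimalActionLimit MinimalActionDictionary
open B11 (VarProblem Regularity)
open B11Thm1 (Thm1At Exists8 Reg910)

noncomputable section

variable {d : ℕ} {n : Type} [Fintype n] [DecidableEq n]


/-! ## THE END: Theorem 1 for the torus instances ⇒ `UpperData` ⇒ the minimal actions converge -/

/-- **B11 THEOREM 1 (TYPED, AS A HYPOTHESIS) GIVES THE UPPER-HALF DATA OF THE SANDWICH.**  For `L ≥ 2`, a local-gauge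
shape `G` monotone in its radii (`hG`) and in its cube (`hGbox`: a gauge on `box K y` is one on every smaller concentric
box) which feeds the `ℓ²` flux-gradient slot with constant `g` at radii `(c∕L^j, c∕L^{2j}, c∕L^{3j})` (`hgrad` — row
NE3-R2's `gradFluxSq_period_le_scaling` for `G = ExpGauge d`), constants `C` of Theorem 1 with `(7∕3)ε₁ ≤ a₁`, a choice of
REGULARITY CUBES `box (Kc j) (L^j•q)` of print-admissible size (`hMc`: `M_j = cubeM L j (Kc j) ≤ M(ε₁^{(j)})`) containing
the slot boxes (`hKc`: `L^j − 1 + L^j + 2 ≤ Kc j`) with radii under `c` (`hc`: `B₃·M_j·ε₁^{(j)} ≤ c`), the smallness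
`512(d+1)(d+4)L²·(7∕3)B₃ε₁ ≤ 1` and `49·C₀·B₃ε₁ ≤ 9`, and THEOREM 1 AT CONSTANTS `C` FOR THE TORUS INSTANCES OF ALL
LEVELS `k ≥ 1`: every datum `V` with (7) (`V ∈ sfClass d L N ε₁ 0`) has `UpperData d (thm1Class d L N C ε₁) L N
((7∕3)B₃ε₁) g V` — (H1) from (8) at `ε₁^{(k)}`, (H3) from (8)–(10) on the cubes `box (Kc (k+1)) (L^{k+1}•q)` through
`gauge_of_regularity`, `hGbox` and `hgrad`, (H4) from B7 Prop. 1 and `radius_step`.  CONDITIONAL on the displayed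
hypotheses; asserts nothing of B11. [cite: Balaban1985Variational, Thm 1 (8)–(10) p.279] -/
theorem upperData_of_thm1At [Nonempty n] {G : (Site d → Fin d → (Matrix n n ℂ)ˣ) → Site d → ℕ → ℝ → ℝ → ℝ → Prop} {L N : ℕ}
    (hL : 2 ≤ L)
    (hG : RadiiMono d G)
    (hGbox : ∀ (U : Site d → Fin d → (Matrix n n ℂ)ˣ) (y : Site d) (K K' : ℕ) (a₀ a₁ a₂ : ℝ), K' ≤ K →
      G U y K a₀ a₁ a₂ → G U y K' a₀ a₁ a₂) {c g : ℝ}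
    (hgrad : ∀ (j : ℕ) (U : Site d → Fin d → (Matrix n n ℂ)ˣ), IsUnitaryCfg U →
      (∀ q : Site d, G U (((L ^ j : ℕ) : ℤ) • q) (L ^ j - 1 + L ^ j + 2)
        (c / ((L ^ j : ℕ) : ℝ)) (c / ((L ^ j : ℕ) : ℝ) ^ 2) (c / ((L ^ j : ℕ) : ℝ) ^ 3)) →
      gradFluxSq U (periodBox (N * L ^ j)) ≤ g * (N : ℝ) ^ d * ((L : ℝ) ^ j) ^ d / ((L : ℝ) ^ j) ^ 6)
    (C : B11Thm1.Consts) {ε₁ : ℝ} (hε₁ : 0 < ε₁) (ha₁ : 7 / 3 * ε₁ ≤ C.a₁)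
    {Kc : ℕ → ℕ} (hKc : ∀ j : ℕ, L ^ j - 1 + L ^ j + 2 ≤ Kc j)
    (hMc : ∀ j : ℕ, cubeM L j (Kc j) ≤ C.Mfun (levelEps ε₁ L j))
    (hc : ∀ j : ℕ, C.B₃ * cubeM L j (Kc j) * levelEps ε₁ L j ≤ c)
    (hsm : 512 * (d + 1) * (d + 4) * (L : ℝ) ^ 2 * (7 / 3 * (C.B₃ * ε₁)) ≤ 1)
    (hC₀ : lossConst d * (C.B₃ * ε₁) * 49 ≤ 9)
    (hThm : ∀ k : ℕ, Thm1At C (torusVP d L N G (k + 1)))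
    {V : Site d → Fin d → (Matrix n n ℂ)ˣ} (hV : V ∈ sfClass d L N ε₁ 0) :
    UpperData d (thm1Class d L N C ε₁) L N (7 / 3 * (C.B₃ * ε₁)) g V := by
  have hL1 : 1 ≤ L := by omega
  have hL0 : (0 : ℝ) < L := by exact_mod_cast (by omega : 0 < L)
  have hB₃ : 0 ≤ C.B₃ := C.B₃_pos.le
  have he : 0 ≤ C.B₃ * ε₁ := mul_nonneg hB₃ hε₁.le
  set e : ℝ := C.B₃ * ε₁ with hedef
  -- Theorem 1 at level `k+1`, invoked at `ε₁^{(k+1)}`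
  have hT : ∀ k : ℕ, Exists8 (torusVP d L N G (k + 1)) C.B₃ (levelEps ε₁ L (k + 1)) V ∧
      Reg910 (torusVP d L N G (k + 1)) C.B₃ C.B₄ (levelEps ε₁ L (k + 1)) (C.Mfun (levelEps ε₁ L (k + 1))) V := by
    intro k
    have hpos : 0 < levelEps ε₁ L (k + 1) := lt_of_lt_of_le hε₁ (le_levelEps hL hε₁.le _)
    have hle : levelEps ε₁ L (k + 1) ≤ C.a₁ := (levelEps_le hL hε₁.le _).trans ha₁
    have h7 : (torusVP d L N G (k + 1)).Reg7 (levelEps ε₁ L (k + 1)) V :=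
      sfClass_mono (le_levelEps hL hε₁.le _) hV
    obtain ⟨h8, -, h910⟩ := hThm k _ hpos hle V h7
    exact ⟨h8, h910⟩
  -- the radius bookkeeping
  have hrad : ∀ k, C.B₃ * levelEps ε₁ L (k + 1) ≤ 7 / 3 * e := fun k => by
    rw [hedef, mul_comm (7 / 3 : ℝ), mul_assoc]
    exact mul_le_mul_of_nonneg_left (by have := levelEps_le hL hε₁.le (k + 1); linarith) hB₃
  have hclass : ∀ k, thm1Class (n := n) d L N C ε₁ (k + 1) = sfClass d L N (C.B₃ * levelEps ε₁ L (k + 1)) (k + 1) :=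
    fun k => rfl
  -- a minimiser of run `k+1` lies in the class of radius `B₃ ε₁^{(k+1)}`
  have hmem : ∀ (k : ℕ) (U : Site d → Fin d → (Matrix n n ℂ)ˣ), IsMinimiser d (thm1Class d L N C ε₁) L N (k + 1) V U →
      U ∈ sfClass d L N (C.B₃ * levelEps ε₁ L (k + 1)) (k + 1) := fun k U hU => hU.mem.1
  refine ⟨?_, ?_, ?_⟩
  · -- (H1)
    rintro (_ | k)
    · refine ⟨V, isMinimiser_zero ?_⟩
      show V ∈ sfClass d L N (thm1Radius C ε₁ L 0) 0
      refine sfClass_mono ?_ hV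
      show ε₁ ≤ C.B₃ * levelEps ε₁ L 0 + ε₁
      have : 0 ≤ C.B₃ * levelEps ε₁ L 0 := mul_nonneg hB₃ ((hε₁.le).trans (le_levelEps hL hε₁.le 0))
      linarith
    · obtain ⟨⟨U, -, -, hmin⟩, -⟩ := hT k
      exact ⟨U, (isMinimiser_congr (hclass k)).mpr hmin⟩
  · -- (H3)
    intro k U hU
    obtain ⟨hu, hp, hs⟩ := hmem k U hU
    refine ⟨hu, hp, SmallField.mono hs (div_le_div_of_nonneg_right (hrad k) (by positivity)), ?_⟩
    -- the gradient slot through (9)–(10)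
    obtain ⟨-, h910⟩ := hT k
    have hmin : (torusVP d L N G (k + 1)).OnMinimalOrbit (C.B₃ * levelEps ε₁ L (k + 1)) V U :=
      (isMinimiser_congr (hclass k)).mp hU
    refine hgrad (k + 1) U hu fun q => ?_
    have hsize : (torusVP d L N G (k + 1)).sizeM ((((L ^ (k + 1) : ℕ) : ℤ) • q), Kc (k + 1))
        ≤ C.Mfun (levelEps ε₁ L (k + 1)) := hMc (k + 1)
    have hreg := h910 U hmin _ hsize
    have hg := hGbox _ _ _ _ _ _ _ (hKc (k + 1)) (gauge_of_regularity hG hL1 hreg (hc (k + 1)))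
    simpa only [Nat.cast_pow] using hg
  · -- (H4)
    intro k U hU
    obtain ⟨hu, hp, hs⟩ := hmem k U hU
    set r : ℝ := C.B₃ * levelEps ε₁ L (k + 1) with hrdef
    have hr0 : 0 ≤ r := mul_nonneg hB₃ ((hε₁.le).trans (le_levelEps hL hε₁.le _))
    have hs2 : 1 ≤ ((L : ℝ) ^ (k + 1)) ^ 2 := one_le_pow₀ (one_le_pow₀ (by exact_mod_cast hL1))
    have ha : 0 ≤ r / ((L : ℝ) ^ (k + 1)) ^ 2 := div_nonneg hr0 (by positivity)
    have hsmall : 512 * (d + 1) * (d + 4) * (L : ℝ) ^ 2 * (r / ((L : ℝ) ^ (k + 1)) ^ 2) ≤ 1 := by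
      have hab : r / ((L : ℝ) ^ (k + 1)) ^ 2 ≤ 7 / 3 * e := (div_le_self hr0 hs2).trans (hrad k)
      have hc' : 0 ≤ 512 * ((d : ℝ) + 1) * (d + 4) * (L : ℝ) ^ 2 := by positivity
      exact (mul_le_mul_of_nonneg_left hab hc').trans hsm
    refine ⟨isUnitaryCfg_rescale_bavg L hL1 hu ha hsmall hs, ?_, ?_⟩
    · refine isPeriodicCfg_rescale_bavg L ?_
      have : ((N * L ^ (k + 1) : ℕ) : ℤ) = (L : ℤ) * ((N * L ^ k : ℕ) : ℤ) := by push_cast; ring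
      rw [← this]; exact hp
    · refine SmallField.mono (smallField_rescale_bavg L hL1 hu ha hsmall hs) ?_
      rw [avgRadius_level hL1]
      refine div_le_div_of_nonneg_right ?_ (by positivity)
      have hstep := radius_step (d := d) hL he hC₀ k
      have h1 : r + lossConst d * r ^ 2 * (((L : ℝ) ^ 2)⁻¹) ^ k ≤ e * (1 + tailSum L k) := by
        have : r = e * (1 + tailSum L (k + 1)) := by rw [hrdef, hedef, levelEps]; ring
        rw [this]; exact hstep
      refine h1.trans ?_
      have h2 : e * (1 + tailSum L k) = C.B₃ * levelEps ε₁ L k := by rw [hedef, levelEps]; ring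
      rw [h2]
      exact radius_le_thm1Radius C hε₁.le L k

/-- **HENCE THE MINIMAL ACTIONS CONVERGE** — `∃ A, A_k(V) → A` for every datum `V` with (7), from B11 Theorem 1 for the
torus instances (hypothesis), the `G`-gradient slot (hypothesis) and the kernel-checked sandwich
(`MinimalActionLimit.exists_tendsto_minAct`): rung-(B)+1 «existence of the `ε → 0` limit of the minimal actions»,
CONDITIONAL as displayed; not NE3, not summit progress. [cite: Balaban1985Variational, Thm 1 (8)–(10) p.279] -/
theorem exists_tendsto_minAct_of_thm1At [Nonempty n]
    {G : (Site d → Fin d → (Matrix n n ℂ)ˣ) → Site d → ℕ → ℝ → ℝ → ℝ → Prop} {L N : ℕ} (hL : 2 ≤ L)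
    (hN : 1 ≤ N) (hG : RadiiMono d G)
    (hGbox : ∀ (U : Site d → Fin d → (Matrix n n ℂ)ˣ) (y : Site d) (K K' : ℕ) (a₀ a₁ a₂ : ℝ), K' ≤ K →
      G U y K a₀ a₁ a₂ → G U y K' a₀ a₁ a₂) {c g : ℝ} (hg : 0 ≤ g)
    (hgrad : ∀ (j : ℕ) (U : Site d → Fin d → (Matrix n n ℂ)ˣ), IsUnitaryCfg U →
      (∀ q : Site d, G U (((L ^ j : ℕ) : ℤ) • q) (L ^ j - 1 + L ^ j + 2)
        (c / ((L ^ j : ℕ) : ℝ)) (c / ((L ^ j : ℕ) : ℝ) ^ 2) (c / ((L ^ j : ℕ) : ℝ) ^ 3)) →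
      gradFluxSq U (periodBox (N * L ^ j)) ≤ g * (N : ℝ) ^ d * ((L : ℝ) ^ j) ^ d / ((L : ℝ) ^ j) ^ 6)
    (C : B11Thm1.Consts) {ε₁ : ℝ} (hε₁ : 0 < ε₁) (ha₁ : 7 / 3 * ε₁ ≤ C.a₁)
    {Kc : ℕ → ℕ} (hKc : ∀ j : ℕ, L ^ j - 1 + L ^ j + 2 ≤ Kc j)
    (hMc : ∀ j : ℕ, cubeM L j (Kc j) ≤ C.Mfun (levelEps ε₁ L j))
    (hc : ∀ j : ℕ, C.B₃ * cubeM L j (Kc j) * levelEps ε₁ L j ≤ c)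
    (hsm : 512 * (d + 1) * (d + 4) * (L : ℝ) ^ 2 * (7 / 3 * (C.B₃ * ε₁)) ≤ 1)
    (hC₀ : lossConst d * (C.B₃ * ε₁) * 49 ≤ 9)
    (hThm : ∀ k : ℕ, Thm1At C (torusVP d L N G (k + 1)))
    {V : Site d → Fin d → (Matrix n n ℂ)ˣ} (hV : V ∈ sfClass d L N ε₁ 0) :
    ∃ A : ℝ, Tendsto (fun k => minAct d (thm1Class d L N C ε₁) L N k V) atTop (𝓝 A) :=
  exists_tendsto_minAct hL hN (by have := C.B₃_pos.le; positivity) hsm hg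
    (upperData_of_thm1At hL hG hGbox hgrad C hε₁ ha₁ hKc hMc hc hsm hC₀ hThm hV)

end

end Summit.QuantumFields.BalabanUV.T4Continuum.MinimalActionFromThm1
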